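import Literature.Algebra.EuclideanLattices.IntegerMatrixInverseGS
import Literature.Algebra.EuclideanLattices.FineGridGaussian
import Literature.Algebra.EuclideanLattices.GaussianSublatticeUniformity
import Mathlib.Data.ZMod.Basic
import Mathlib.GroupTheory.QuotientGroup.Basic
import HarnessLib

/-!
# The scaled dual lattice `Λ = det(B)²·L(B)*` inside the fine grid `(1/N)ℤⁿ`: a finite model of `(1/N)ℤⁿ/Λ` with computable coset representatives

Topic `Algebra/EuclideanLattices` (family `pqc`). Concrete model in which the bit-level rendering of the
first step of Micciancio–Regev 2007, Thm. 5.23 (Cor. 5.13 on the DUAL lattice; the verifier-free route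
`Literature.Computability.Cryptography.owfExist_of_gapSVP_worstCaseHard_of_shortDual`) runs the
fine-grid sampling lemma `Literature.Algebra.EuclideanLattices.MicciancioRegev2007.map_gridSample_apply`
(`GaussianSublatticeUniformity.lean`: a superlattice `L' ⊇ L`, a finite group `G`, `φ : L' →+ G` onto
with kernel `L`, and a section `rep`). Everything a machine handles is an INTEGER vector:

* the lattice: for a nonsingular integer `B` (rows `bᵢ`, primal lattice `L(B)`), `Dg = det(B)²`,
  `G = invMatrix B` (`B G = Dg I = G B`, `IntegerMatrixInverseGS.lean`), and **`Λ = G ℤⁿ`** (integer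
  combinations of the COLUMNS of `G`; `Λ = Dg · L(B)*`, `dualInst B = ⟨n, Gᵀ⟩`, `mem_dualLat_iff`,
  `smul_mem_dualLattice_of_mem_dualLat`); `Dg ℤⁿ ⊆ Λ ⊆ ℤⁿ ⊆ (1/N)ℤⁿ`;
* the group: `Mo = N·Dg`, `Hsub ≤ (ℤ/Mo)ⁿ` the image of `N G ℤⁿ`, **`Grp B N = (ℤ/Mo)ⁿ ⧸ Hsub`**
  (a `Fintype`), and **`phi B N : fineGrid n N →+ Grp B N`**, `x ↦ [N x mod Mo]` — onto
  (`phi_surjective`) with kernel exactly `Λ` (`phi_eq_zero_iff`);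
* the representatives: `reduceVec B N K = K - N G ⌊B K/(N Dg)⌋` (reduction of `K/N` modulo the
  parallelepiped of the columns of `G`, in grid units; integer floor division), constant on cosets
  (`reduceVec_congr`), and the section **`rep B N : Grp B N → fineGrid n N`** it induces
  (`phi_rep`, `rep_phi` : `rep (φ (K/N)) = reduceVec K / N`);
* **`gridSample_eq`** — the sampling procedure of Lemma 5.7 in this model is explicit: for a grid noise
  `r = K/N`, `gridSample φ … rep … (K/N) = (φ(-K/N), y)` with the LATTICE vector
  `y = -G ⌊B(-K)/(N Dg)⌋… = -(G F)`, `F = ⌊-B K/(N Dg)⌋` (`coe_gridSample_snd_eq`), an integer vector.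

All proved; definitions with bodies; no named fact.

## References

* D. Micciancio, O. Regev, *Worst-case to average-case reductions based on Gaussian measures*,
  SIAM J. Comput. 37 (2007) 267–302; authors' version, Lemma 5.7 (p. 20: `c = -r mod P(B)`,
  `y = r + c`) and the proof of Thm. 5.23, first step (p. 29: Cor. 5.13 applied to `L(B)*`).
* D. Micciancio, S. Goldwasser, *Complexity of Lattice Problems*, Kluwer 2002, Ch. 1 §1 (the dual
  lattice `L(B)* = L((B⁻¹)ᵀ)`; reduction modulo the fundamental parallelepiped) [MicciancioGoldwasser2002].
-/

noncomputable section

open scoped Classical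

namespace Literature.Algebra.EuclideanLattices

open Module Submodule Matrix GSInverse

namespace DualGrid

variable {n : ℕ} (B : Matrix (Fin n) (Fin n) ℤ)

/-! ### The scaled dual lattice `Λ = G ℤⁿ` -/

/-- The common denominator `Dg = dₙ = det(B)²` (as an integer; `invDen` of Cohen's table). [folklore] -/
def Dg : ℤ := invDen (rowsOf B)

/-- The integer matrix `G` with `B G = Dg I` (`GSInverse.invMatrix`). [folklore] -/
def G : Matrix (Fin n) (Fin n) ℤ := invMatrix B

variable {B}

/-- `Dg = det(B)²`. [cite: Cohen1993, §2.6.3] -/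
theorem Dg_eq (hB : B.det ≠ 0) : Dg B = B.det ^ 2 := invDen_eq_det_sq hB

/-- `Dg > 0`. [folklore] -/
theorem Dg_pos (hB : B.det ≠ 0) : 0 < Dg B := by
  rw [Dg_eq hB]; positivity

/-- `B G = Dg I`. [cite: Cohen1993, §2.6.3] -/
theorem B_mul_G (hB : B.det ≠ 0) : B * G B = Dg B • (1 : Matrix (Fin n) (Fin n) ℤ) :=
  mul_invMatrix_eq_invDen hB

/-- `G B = Dg I` (a one-sided inverse of a square matrix is two-sided). [folklore] -/
theorem G_mul_B (hB : B.det ≠ 0) : G B * B = Dg B • (1 : Matrix (Fin n) (Fin n) ℤ) := by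
  -- pass to `ℝ`, where `B` is invertible
  have hinj : Function.Injective (fun M : Matrix (Fin n) (Fin n) ℤ => M.map (Int.cast : ℤ → ℝ)) :=
    fun M M' h => Matrix.ext fun i j => by
      have := congrFun (congrFun h i) j
      simpa [Matrix.map_apply] using this
  apply hinj
  have hdet : IsUnit (B.map (Int.cast : ℤ → ℝ)).det := by
    rw [show B.map (Int.cast : ℤ → ℝ) = (Int.castRingHom ℝ).mapMatrix B from rfl, ← RingHom.map_det,
      isUnit_iff_ne_zero, eq_intCast]
    exact_mod_cast hB
  have hBG : B.map (Int.cast : ℤ → ℝ) * (G B).map (Int.cast : ℤ → ℝ) = ((Dg B : ℤ) : ℝ) • (1 : Matrix (Fin n) (Fin n) ℝ) := by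
    have e := (Matrix.map_mul (f := Int.castRingHom ℝ) (L := B) (M := G B)).symm
    change B.map (Int.cast : ℤ → ℝ) * (G B).map (Int.cast : ℤ → ℝ) = (B * G B).map (Int.cast : ℤ → ℝ) at e
    rw [e, B_mul_G hB]
    ext i j
    rw [Matrix.map_apply, Matrix.smul_apply, Matrix.smul_apply, Matrix.one_apply, Matrix.one_apply]
    split_ifs <;> simp
  -- `G = Dg • B⁻¹`, hence `G B = Dg I`
  have hG : (G B).map (Int.cast : ℤ → ℝ) = ((Dg B : ℤ) : ℝ) • (B.map (Int.cast : ℤ → ℝ))⁻¹ := by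
    have h := congrArg (fun M => (B.map (Int.cast : ℤ → ℝ))⁻¹ * M) hBG
    rwa [← Matrix.mul_assoc, Matrix.nonsing_inv_mul _ hdet, Matrix.one_mul, Matrix.mul_smul, Matrix.mul_one] at h
  have e2 : (G B * B).map (Int.cast : ℤ → ℝ) = (G B).map (Int.cast : ℤ → ℝ) * B.map (Int.cast : ℤ → ℝ) :=
    Matrix.map_mul (f := Int.castRingHom ℝ)
  show (G B * B).map (Int.cast : ℤ → ℝ) = (Dg B • (1 : Matrix (Fin n) (Fin n) ℤ)).map (Int.cast : ℤ → ℝ)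
  rw [e2, hG, Matrix.smul_mul, Matrix.nonsing_inv_mul _ hdet]
  ext i j
  rw [Matrix.map_apply, Matrix.smul_apply, Matrix.smul_apply, Matrix.one_apply, Matrix.one_apply]
  split_ifs <;> simp

/-- Entrywise: `B (G v) = Dg v`. [folklore] -/
theorem B_mulVec_G_mulVec (hB : B.det ≠ 0) (v : Fin n → ℤ) : B *ᵥ (G B *ᵥ v) = Dg B • v := by
  rw [Matrix.mulVec_mulVec, B_mul_G hB, Matrix.smul_mulVec, Matrix.one_mulVec]

/-- Entrywise: `G (B v) = Dg v`. [folklore] -/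
theorem G_mulVec_B_mulVec (hB : B.det ≠ 0) (v : Fin n → ℤ) : G B *ᵥ (B *ᵥ v) = Dg B • v := by
  rw [Matrix.mulVec_mulVec, G_mul_B hB, Matrix.smul_mulVec, Matrix.one_mulVec]

variable (B)

/-- **The scaled dual lattice as a lattice instance**: rows = the COLUMNS of `G` (`⟨n, Gᵀ⟩`), so that
its lattice is `Λ = G ℤⁿ = Dg · L(B)*`. [cite: MicciancioGoldwasser2002, Ch. 1 §1] -/
def dualInst : LatticeInstance := ⟨n, (G B).transpose⟩

/-- `Λ = G ℤⁿ` as a `ℤ`-submodule of `ℝⁿ`. [cite: MicciancioGoldwasser2002, Ch. 1 §1] -/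
abbrev dualLat : Submodule ℤ (EuclideanSpace ℝ (Fin n)) := (dualInst B).lattice

/-- The integer combinations of the columns of `G` are the vectors `G z`. [folklore] -/
theorem ofCoeffs_dualInst (z : Fin n → ℤ) : (dualInst B).ofCoeffs z = intVecToEuclidean n (G B *ᵥ z) := by
  change intVecToEuclidean n (Matrix.vecMul z (G B).transpose) = _
  rw [Matrix.vecMul_transpose]

/-- **Membership in `Λ`**: `x ∈ Λ ↔ x = G z` for an integer vector `z`. [folklore] -/
theorem mem_dualLat_iff (x : EuclideanSpace ℝ (Fin n)) : x ∈ dualLat B ↔ ∃ z : Fin n → ℤ, intVecToEuclidean n (G B *ᵥ z) = x := by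
  have h := LatticeInstance.mem_lattice_iff (dualInst B) x
  simp only [ofCoeffs_dualInst] at h
  exact h

/-- `G z ∈ Λ`. [folklore] -/
theorem G_mulVec_mem_dualLat (z : Fin n → ℤ) : intVecToEuclidean n (G B *ᵥ z) ∈ dualLat B :=
  (mem_dualLat_iff B _).2 ⟨z, rfl⟩

variable {B}

/-- **`Dg ℤⁿ ⊆ Λ`**: `Dg v = G (B v)`. [folklore] -/
theorem Dg_smul_mem_dualLat (hB : B.det ≠ 0) (v : Fin n → ℤ) : intVecToEuclidean n (Dg B • v) ∈ dualLat B := by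
  rw [← G_mulVec_B_mulVec hB]
  exact G_mulVec_mem_dualLat B _

/-- **`Λ/Dg ⊆ L(B)*`**: for `x = G z ∈ Λ`, `x/Dg` pairs integrally with every row of `B`
(`⟨G z / Dg, bᵢ⟩ = (B G z)ᵢ/Dg = zᵢ`). [cite: MicciancioGoldwasser2002, Ch. 1 §1 (L(B)* = L((B⁻¹)ᵀ))] -/
theorem inner_G_mulVec_vec (hB : B.det ≠ 0) (z : Fin n → ℤ) (i : Fin n) :
    inner ℝ (((Dg B : ℤ) : ℝ)⁻¹ • intVecToEuclidean n (G B *ᵥ z)) ((⟨n, B⟩ : LatticeInstance).vec i) = (z i : ℝ) := by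
  have hD : ((Dg B : ℤ) : ℝ) ≠ 0 := by exact_mod_cast (Dg_pos hB).ne'
  set w : Fin n → ℤ := G B *ᵥ z with hw
  have hrow : (B *ᵥ w) i = Dg B * z i := by
    rw [hw, B_mulVec_G_mulVec hB]; simp
  have hsum : ∑ j, ((B i j : ℤ) : ℝ) * ((w j : ℤ) : ℝ) = ((Dg B : ℤ) : ℝ) * z i := by
    have := congrArg (fun t : ℤ => (t : ℝ)) hrow
    simp only [Matrix.mulVec, dotProduct, Int.cast_sum, Int.cast_mul] at this
    exact this
  rw [real_inner_smul_left]
  simp only [LatticeInstance.vec, PiLp.inner_apply, intVecToEuclidean_apply, RCLike.inner_apply, conj_trivial]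
  rw [hsum]; field_simp

/-! ### The finite group `(ℤ/Mo)ⁿ ⧸ (N G ℤⁿ)` and the map `φ` -/

variable (B) (N : ℕ)

/-- The modulus `Mo = N · Dg` of the finite model. [folklore] -/
def Mo : ℕ := N * (Dg B).toNat

variable {B N} in
/-- `Mo ≠ 0` for nonsingular `B` and `N ≠ 0`. [folklore] -/
theorem neZero_Mo (hB : B.det ≠ 0) [NeZero N] : NeZero (Mo B N) :=
  ⟨Nat.mul_ne_zero (NeZero.ne N) (by have := Dg_pos hB; omega)⟩

/-- Casting an integer vector modulo `Mo`. [folklore] -/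
def castVec : (Fin n → ℤ) →+ (Fin n → ZMod (Mo B N)) where
  toFun K := fun i => (K i : ZMod (Mo B N))
  map_zero' := by funext i; simp
  map_add' K K' := by funext i; simp

/-- `castVec K i = K i mod Mo`. [folklore] -/
@[simp] theorem castVec_apply (K : Fin n → ℤ) (i : Fin n) : castVec B N K i = (K i : ZMod (Mo B N)) := rfl

/-- The map `z ↦ N G z` as an additive homomorphism. [folklore] -/
def scaledG : (Fin n → ℤ) →+ (Fin n → ℤ) :=
  (nsmulAddMonoidHom N).comp (Matrix.mulVecLin (G B)).toAddMonoidHom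

/-- `scaledG z = N • G z`. [folklore] -/
@[simp] theorem scaledG_apply (z : Fin n → ℤ) : scaledG B N z = N • (G B *ᵥ z) := rfl

/-- The subgroup `H = image of N G ℤⁿ` of `(ℤ/Mo)ⁿ`. [folklore] -/
def Hsub : AddSubgroup (Fin n → ZMod (Mo B N)) := ((castVec B N).comp (scaledG B N)).range

/-- **The finite group `Grp = (ℤ/Mo)ⁿ ⧸ H`** modelling `(1/N)ℤⁿ/Λ`. [cite: MicciancioRegev2007, Lemma 5.7 (P(B) as coset representatives)] -/
abbrev Grp : Type := (Fin n → ZMod (Mo B N)) ⧸ Hsub B N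

/-- `Grp` is finite (a quotient of a finite group; needs `Mo ≠ 0`). [folklore] -/
instance instFintypeGrp [NeZero (Mo B N)] : Fintype (Grp B N) := QuotientAddGroup.fintype (Hsub B N)

variable [NeZero N]

/-- **The map `φ : (1/N)ℤⁿ →+ Grp`, `x ↦ [N x mod Mo]`.** [cite: MicciancioRegev2007, Lemma 5.7 (c = -r mod P(B))] -/
def phi : fineGrid n N →+ Grp B N :=
  (QuotientAddGroup.mk' (Hsub B N)).comp ((castVec B N).comp (fineGridEquiv n N).symm.toAddMonoidHom)

/-- `φ (K/N) = [K mod Mo]`. [folklore] -/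
theorem phi_fineGridEquiv (K : Fin n → ℤ) : phi B N (fineGridEquiv n N K) = QuotientAddGroup.mk' (Hsub B N) (castVec B N K) := by
  simp [phi]

variable {B N} in
/-- `φ` is onto. [folklore] -/
theorem phi_surjective (hB : B.det ≠ 0) : Function.Surjective (phi B N) := by
  haveI := neZero_Mo (N := N) hB
  intro a
  obtain ⟨v, rfl⟩ := QuotientAddGroup.mk'_surjective (Hsub B N) a
  refine ⟨fineGridEquiv n N fun i => ((v i).val : ℤ), ?_⟩
  rw [phi_fineGridEquiv]
  congr 1
  funext i
  rw [castVec_apply, Int.cast_natCast, ZMod.natCast_zmod_val]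

variable {B N}

omit [NeZero N] in
/-- Two integer vectors have the same class in `Grp` iff they differ by `N G d + Mo ℓ`. [folklore] -/
theorem mk_castVec_eq_iff (K K' : Fin n → ℤ) :
    (QuotientAddGroup.mk' (Hsub B N) (castVec B N K) = QuotientAddGroup.mk' (Hsub B N) (castVec B N K')) ↔
      ∃ (d ℓ : Fin n → ℤ), K' = K + N • (G B *ᵥ d) + (Mo B N : ℤ) • ℓ := by
  rw [QuotientAddGroup.mk'_eq_mk', ]
  constructor
  · rintro ⟨h, hh, hK⟩
    obtain ⟨d, rfl⟩ := hh
    -- `castVec K' = castVec K + castVec (N G d)`, so `K' - K - N G d ≡ 0 (mod Mo)` coordinatewise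
    have hcoord : ∀ i, ((K' i - (K i + (N • (G B *ᵥ d)) i) : ℤ) : ZMod (Mo B N)) = 0 := by
      intro i
      have := congrFun hK i
      simp only [Pi.add_apply, castVec_apply, AddMonoidHom.coe_comp, Function.comp_apply, scaledG_apply] at this
      push_cast
      rw [← this]; ring
    choose ℓ hℓ using fun i => (ZMod.intCast_zmod_eq_zero_iff_dvd _ _).1 (hcoord i)
    refine ⟨d, ℓ, funext fun i => ?_⟩
    simp only [Pi.add_apply, Pi.smul_apply, smul_eq_mul]
    have := hℓ i
    simp only [Pi.smul_apply, nsmul_eq_mul] at this ⊢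
    linarith
  · rintro ⟨d, ℓ, rfl⟩
    refine ⟨castVec B N (N • (G B *ᵥ d)), ⟨d, rfl⟩, funext fun i => ?_⟩
    simp only [Pi.add_apply, castVec_apply, Pi.smul_apply, smul_eq_mul]
    push_cast
    rw [ZMod.natCast_self, zero_mul, add_zero]

/-- **The kernel of `φ` is `Λ`**: `φ(K/N) = 0 ↔ K/N ∈ Λ`. [cite: MicciancioRegev2007, Lemma 5.7] -/
theorem phi_eq_zero_iff (hB : B.det ≠ 0) (x : fineGrid n N) : phi B N x = 0 ↔ (x : EuclideanSpace ℝ (Fin n)) ∈ dualLat B := by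
  obtain ⟨K, rfl⟩ := (fineGridEquiv n N).surjective x
  have hN : (N : ℝ) ≠ 0 := NeZero.ne (N : ℝ)
  have hDg : (Dg B).toNat = Dg B := Int.toNat_of_nonneg (Dg_pos hB).le
  rw [phi_fineGridEquiv, show (0 : Grp B N) = QuotientAddGroup.mk' (Hsub B N) (castVec B N 0) by simp,
    eq_comm, mk_castVec_eq_iff, coe_fineGridEquiv, mem_dualLat_iff]
  constructor
  · rintro ⟨d, ℓ, hK⟩
    simp only [zero_add] at hK
    -- `K = N G d + Mo ℓ = N G (d + B ℓ)`
    refine ⟨d + B *ᵥ ℓ, ?_⟩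
    have hK' : K = N • (G B *ᵥ (d + B *ᵥ ℓ)) := by
      rw [Matrix.mulVec_add, G_mulVec_B_mulVec hB, smul_add, hK]
      congr 1
      funext i
      simp only [Pi.smul_apply, smul_eq_mul, nsmul_eq_mul, Mo, Nat.cast_mul, hDg]
      ring
    have hKi : ∀ i, K i = (N : ℤ) * (G B *ᵥ (d + B *ᵥ ℓ)) i := fun i => by
      rw [hK', Pi.smul_apply, nsmul_eq_mul]
    ext i
    simp only [intVecToEuclidean_apply, fineGridVec_apply, hKi, Int.cast_mul, Int.cast_natCast]
    field_simp
  · rintro ⟨z, hz⟩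
    refine ⟨z, 0, ?_⟩
    simp only [zero_add, smul_zero, add_zero]
    funext i
    have := congrArg (fun v : EuclideanSpace ℝ (Fin n) => v i) hz
    simp only [intVecToEuclidean_apply, fineGridVec_apply] at this
    have h2 : ((K i : ℤ) : ℝ) = N * ((G B *ᵥ z) i : ℝ) := by
      rw [this]; field_simp
    rw [Pi.smul_apply, nsmul_eq_mul]
    exact_mod_cast h2

/-! ### Reduction modulo the parallelepiped of `G`, and the section `rep` -/

variable (B N)

/-- **Reduction of `K/N` modulo the parallelepiped of the columns of `G`, in grid units**:
`reduceVec K = K - N G ⌊B K/(N Dg)⌋` (coordinatewise integer floor division; `G⁻¹ = B/Dg`).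
[cite: MicciancioGoldwasser2002, Ch. 1 §1 (x mod P(B) = x - B⌊B⁻¹x⌋)] -/
def reduceVec (K : Fin n → ℤ) : Fin n → ℤ :=
  K - N • (G B *ᵥ fun i => (B *ᵥ K) i / ((N : ℤ) * Dg B))

variable {B N}

/-- **`reduceVec` is constant on cosets**: `reduceVec (K + N G d + Mo ℓ) = reduceVec K`. [folklore] -/
theorem reduceVec_congr (hB : B.det ≠ 0) (K d ℓ : Fin n → ℤ) :
    reduceVec B N (K + N • (G B *ᵥ d) + (Mo B N : ℤ) • ℓ) = reduceVec B N K := by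
  have hDg : ((Dg B).toNat : ℤ) = Dg B := Int.toNat_of_nonneg (Dg_pos hB).le
  have hND : 0 < (N : ℤ) * Dg B := mul_pos (by exact_mod_cast Nat.pos_of_ne_zero (NeZero.ne N)) (Dg_pos hB)
  have hK' : K + N • (G B *ᵥ d) + (Mo B N : ℤ) • ℓ = K + N • (G B *ᵥ (d + B *ᵥ ℓ)) := by
    rw [Matrix.mulVec_add, G_mulVec_B_mulVec hB, smul_add, add_assoc]
    congr 2
    funext i
    simp only [Pi.smul_apply, smul_eq_mul, nsmul_eq_mul, Mo, Nat.cast_mul, hDg]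
    ring
  rw [hK']
  unfold reduceVec
  -- the floors shift by `d + B ℓ`
  have hBK : B *ᵥ (K + N • (G B *ᵥ (d + B *ᵥ ℓ))) = B *ᵥ K + ((N : ℤ) * Dg B) • (d + B *ᵥ ℓ) := by
    rw [Matrix.mulVec_add B K, Matrix.mulVec_smul, B_mulVec_G_mulVec hB, ← natCast_zsmul, smul_smul]
  have hfloor : (fun i => (B *ᵥ (K + N • (G B *ᵥ (d + B *ᵥ ℓ)))) i / ((N : ℤ) * Dg B)) =
      (fun i => (B *ᵥ K) i / ((N : ℤ) * Dg B)) + (d + B *ᵥ ℓ) := by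
    funext i
    rw [hBK, Pi.add_apply, Pi.add_apply, Pi.smul_apply, smul_eq_mul,
      show (N : ℤ) * Dg B * (d + B *ᵥ ℓ) i = (d + B *ᵥ ℓ) i * ((N : ℤ) * Dg B) by ring,
      Int.add_mul_ediv_right _ _ hND.ne']
  rw [hfloor]
  simp only [Matrix.mulVec_add, smul_add]
  abel

omit [NeZero N] in
/-- The class of `reduceVec K` is the class of `K`. [folklore] -/
theorem mk_castVec_reduceVec (K : Fin n → ℤ) :
    QuotientAddGroup.mk' (Hsub B N) (castVec B N (reduceVec B N K)) = QuotientAddGroup.mk' (Hsub B N) (castVec B N K) := by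
  rw [eq_comm, mk_castVec_eq_iff]
  refine ⟨-(fun i => (B *ᵥ K) i / ((N : ℤ) * Dg B)), 0, ?_⟩
  simp only [smul_zero, add_zero, Matrix.mulVec_neg, smul_neg]
  unfold reduceVec
  abel

variable (B N)

/-- A lift of a class to an integer vector (through `ZMod.val`). [folklore] -/
def liftVec (a : Grp B N) : Fin n → ℤ := fun i => (((Quotient.out a : Fin n → ZMod (Mo B N)) i).val : ℤ)

variable {B N} in
/-- The lift represents the class. [folklore] -/
theorem mk_castVec_liftVec (hB : B.det ≠ 0) (a : Grp B N) :
    QuotientAddGroup.mk' (Hsub B N) (castVec B N (liftVec B N a)) = a := by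
  haveI := neZero_Mo (N := N) hB
  have h : castVec B N (liftVec B N a) = Quotient.out a := by
    funext i
    rw [castVec_apply, show liftVec B N a i = (((Quotient.out a : Fin n → ZMod (Mo B N)) i).val : ℤ) from rfl,
      Int.cast_natCast, ZMod.natCast_zmod_val]
  rw [h]
  exact QuotientAddGroup.out_eq' a

/-- **The section `rep : Grp → (1/N)ℤⁿ`**: the parallelepiped-reduced representative of the class.
[cite: MicciancioRegev2007, Lemma 5.7 (P(B) as coset representatives)] -/
def rep (a : Grp B N) : fineGrid n N := fineGridEquiv n N (reduceVec B N (liftVec B N a))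

variable {B N}

/-- `φ ∘ rep = id`. [folklore] -/
theorem phi_rep (hB : B.det ≠ 0) (a : Grp B N) : phi B N (rep B N a) = a := by
  rw [rep, phi_fineGridEquiv, mk_castVec_reduceVec, mk_castVec_liftVec hB]

/-- **`rep (φ (K/N)) = reduceVec K / N`**: the section on the class of a grid vector is its
parallelepiped reduction. [folklore] -/
theorem rep_phi (hB : B.det ≠ 0) (K : Fin n → ℤ) :
    rep B N (phi B N (fineGridEquiv n N K)) = fineGridEquiv n N (reduceVec B N K) := by
  rw [rep]
  congr 1
  -- the lift of the class of `K` differs from `K` by `N G d + Mo ℓ`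
  have h : QuotientAddGroup.mk' (Hsub B N) (castVec B N K) =
      QuotientAddGroup.mk' (Hsub B N) (castVec B N (liftVec B N (phi B N (fineGridEquiv n N K)))) := by
    rw [mk_castVec_liftVec hB, phi_fineGridEquiv]
  obtain ⟨d, ℓ, hdl⟩ := (mk_castVec_eq_iff _ _).1 h
  rw [hdl, reduceVec_congr hB]

/-! ### The sampling procedure of Lemma 5.7 in the model -/

/-- The kernel condition in the form `GaussianSublatticeUniformity` uses. [folklore] -/
theorem hker (hB : B.det ≠ 0) : ∀ x : fineGrid n N, phi B N x = 0 ↔ (x : EuclideanSpace ℝ (Fin n)) ∈ dualLat B :=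
  phi_eq_zero_iff hB

/-- **The lattice vector of the sampling procedure is explicit**: for a grid noise `r = K/N`, the second
component of `gridSample φ hker rep hrep r` (`y = r + rep(φ(-r)) ∈ Λ`) is the INTEGER vector
`-(G F)` with `F = ⌊B(-K)/(N Dg)⌋… `; precisely `y = (K + reduceVec (-K))/N = -G ⌊-(B K)/(N·Dg)⌋`
coordinatewise. [cite: MicciancioRegev2007, Lemma 5.7 (y = r + c)] -/
theorem coe_gridSample_snd_eq (hB : B.det ≠ 0) (K : Fin n → ℤ) :
    ((MicciancioRegev2007.gridSample (phi B N) (hker hB) (rep B N) (phi_rep hB) (fineGridEquiv n N K)).2 :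
        EuclideanSpace ℝ (Fin n)) =
      intVecToEuclidean n (-(G B *ᵥ fun i => (B *ᵥ (-K)) i / ((N : ℤ) * Dg B))) := by
  rw [MicciancioRegev2007.coe_gridSample_snd, ← map_neg (fineGridEquiv n N), rep_phi hB,
    coe_fineGridEquiv, coe_fineGridEquiv]
  have hN : (N : ℝ) ≠ 0 := NeZero.ne (N : ℝ)
  ext i
  simp only [PiLp.add_apply, fineGridVec_apply, intVecToEuclidean_apply, reduceVec, Pi.sub_apply, Pi.neg_apply,
    Pi.smul_apply]
  simp only [nsmul_eq_mul, Int.cast_sub, Int.cast_neg, Int.cast_mul, Int.cast_natCast]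
  field_simp
  ring

/-- The first component is the class of `-K`. [folklore] -/
theorem gridSample_fst_eq (hB : B.det ≠ 0) (K : Fin n → ℤ) :
    (MicciancioRegev2007.gridSample (phi B N) (hker hB) (rep B N) (phi_rep hB) (fineGridEquiv n N K)).1 =
      QuotientAddGroup.mk' (Hsub B N) (castVec B N (-K)) := by
  rw [MicciancioRegev2007.gridSample_fst, ← map_neg (fineGridEquiv n N), phi_fineGridEquiv]

/-- The representative of the offset class, in grid units: `N · rep(φ(-K/N)) = reduceVec (-K)`. [folklore] -/
theorem coe_rep_gridSample_fst (hB : B.det ≠ 0) (K : Fin n → ℤ) :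
    ((rep B N (MicciancioRegev2007.gridSample (phi B N) (hker hB) (rep B N) (phi_rep hB) (fineGridEquiv n N K)).1 :
        fineGrid n N) : EuclideanSpace ℝ (Fin n)) = fineGridVec n N (reduceVec B N (-K)) := by
  rw [MicciancioRegev2007.gridSample_fst, ← map_neg (fineGridEquiv n N), rep_phi hB, coe_fineGridEquiv]

end DualGrid

end Literature.Algebra.EuclideanLattices

end
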